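import Mathlib
import Summits.MatrixMultiplication.MatrixMultiplication.Theses.HiddenToeplitzCorners
import HarnessLib.Audit

/-!
# Line `torus-shadow-smoothing` — crux `HiddenToeplitzCorners.HiddenCornerLemmaR` (stmt-MatrixMultiplication-10752)

Crux (verbatim, route `MatrixMultiplication/HiddenToeplitzCorners`, item #5, negative side): a linear pencil
`T(X) = Σ X a b • T a b` of `N × N` complex matrices which hides a linearly explained `r × r` corner
`T(X) E = F X` (`rank E = rank F = r`), has Stein displacement rank `rank (T(X) − Z T(X) Zᵀ) ≤ d` for every
`X` (`Z` = lower shift) and is nonsingular somewhere, has `r ≤ 2 d`.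

THE LINE (idea card `Cruxes/HiddenCornerLemmaR/Ideas/torus-shadow-smoothing.md`, triage r1: pass ×2).
The structure torus `D_t = diag(1, t, …, t^{N-1})` satisfies `D_t Z D_t⁻¹ = t Z`, so conjugation by `D_t` (with the
induced re-scaling of the corner) preserves every hypothesis of the crux for `t ≠ 0` and contracts a design, once its
frames are in VALUATION NORMAL FORM (pivot rows `p c`, `q a` = valuations of the columns of `E`, `F`), onto its GRADED
SHADOW: coordinate frames `E⁰ = [e_{p c}]`, `F⁰ = [e_{q a}]` and `S a b` = the part of `T a b` on its LOWEST diagonal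
`i − j = w a b` (its initial form for the torus weight `i − j`).  All CLOSED conditions descend along the explicit
polynomial arc `t ↦ D_t T(X̃^{(t)}) D_t⁻¹ = S(X) + O(t)` (`X̃ a b = t^{-w a b} X a b`): the displacement bound
(rank is lower semicontinuous) and the corner, which survives as the PARTIAL corner `S(X) E⁰ = F⁰ (ε ∘ X)` with the
0/1 mask `ε a b = [w a b = q a − p b]` recording exactly where the bijection `𝒯 → Hom(W, W_F)` survives the limit
(triage r1-2's dying open condition no. 1; `ε ≡ 1` iff the design is ADAPTED).  The other open condition,
nonsingularity, dies too (stmt-7493's graded `(3,9,1)`; the census' roomy "inactive-chain" shadows; this seat's exact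
check: `N = 9`, `E = (e₂,e₅,e₈)`, `g₂ = s³·unit` is an adapted nonsingular `r = 3` design whose shadow has rank 3).
The crux is cut accordingly:

* `stub_valuationNormalForm` (M, provable now) — `GL_r × GL_r` re-basing of the corner puts `E`, `F` in valuation
  normal form and preserves all five hypotheses;
* `stub_shadowDescent` (L, provable now; the explicit `D_t`-orbit / semicontinuity lemma asked for by triage r1-1) —
  initial forms of a pencil with `drk ≤ d` everywhere have `drk ≤ d` everywhere (rank is lower semicontinuous along the
  torus orbit); together with the PROVED `masked_corner` / `exists_lowest_diagonal` this makes the lowest-diagonal shadow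
  of a design in normal form a GRADED PARTIAL-CORNER CONFIGURATION;
* `stub_smoothingRigidity` (XL, HARDEST, the line's bet: torus-fixed extremality) — a graded partial-corner
  configuration which is SMOOTHABLE (it is the shadow of an honest design) is dominated by a graded honest DESIGN with
  the same `r` and the same budget `d`: the losses of bijectivity and of nonsingularity in the limit are never
  essential — nothing non-graded beats the graded class;
* `stub_gradedBound` (L, = the card's `GradedHCLR`, triage's "first contentful stub") — graded (torus-fixed)
  nonsingular designs have `r ≤ 2 d` (expected truth `2 d − 1`, tight by the W-family `W1 = (3,9,2)`, `W2 = (5,25,3)`).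

`HiddenCornerLemmaR_of` composes them (kernel-checked, sorries only in the four stubs):
design ⟶ normal form ⟶ its shadow is a graded partial-corner configuration (masked corner PROVED, `drk` by Stub 2),
smoothable by construction ⟶ a graded design with the same `(r, d)` exists ⟶ `r ≤ 2 d`.
PROVED in this file (no `sorry`): the torus lever `torus_mul_shift`, `shiftT_mul_torus`, `stein_torus_conj`,
`stein_rank_torus_conj` (= the card's `TorusPreservesDisplacement`) and the corner half of the descent `pencil_single`,
`corner_entry`, `lowest_le_corner`, `lowest_column_entry`, `masked_corner`, `exists_lowest_diagonal`.

Conventions.  Everything is stated over existing declarations only (Mathlib + the route file), with the shift `Z`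
written verbatim as in the crux.  "design" = the five hypotheses of the crux; "valuation normal form of `E` with
pivots `p`" = `p` injective, `E (p c) c = 1`, `E i c = 0` for `i < p c`; "lowest diagonal `w a b`" =
`T a b i j ≠ 0 → w a b ≤ i − j` and attained; "graded" = `∃ p q, E i c ≠ 0 → i = p c`, `F i a ≠ 0 → i = q a`,
`T a b i j ≠ 0 → i − j = q a − p b`.

Disproof used: no `Cruxes/HiddenCornerLemmaR/Disproof.lean` exists yet (2026-08-16); the one recorded negative,
stmt-7493 (`(3,9,1)`, singular graded), is honoured — nonsingularity is carried INTO `stub_smoothingRigidity` (the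
smoothing design is honest) and `stub_gradedBound` (hypothesis), never dropped; the dead line `Sketch`
(`ImageFrameDefect`, `HCLRDiag`) is not touched (no defect `α_F`, no diagonal-only data anywhere).
-/

set_option linter.dupNamespace false
set_option linter.unusedVariables false
set_option linter.unusedSectionVars false

namespace Summit.MatrixMultiplication.MatrixMultiplication.Cruxes.HiddenCornerLemmaR.TorusShadowSmoothing

open Matrix BigOperators
open Summit.MatrixMultiplication.MatrixMultiplication.Theses.HiddenToeplitzCorners (HiddenCornerLemmaR)

/-! ## The lever, PROVED (not stubs): the structure torus normalises the shift and the Stein displacement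

These four lemmas are the card's `TorusPreservesDisplacement`, kernel-checked here for the stub-workers of Stub 2
(whose `sorry` body opens with them; the composition itself only needs the four stubs). -/

/-- The structure torus normalises the shift: `D_t Z = t • Z D_t` for `D_t = diag(t^i)` — the identity behind the
whole line (`D_t Z D_t⁻¹ = t Z`). [folklore] -/
theorem torus_mul_shift (N : ℕ) (t : ℂ) :
    Matrix.diagonal (fun i : Fin N => t ^ (i : ℕ)) *
        (Matrix.of fun i j : Fin N => if (i : ℕ) = (j : ℕ) + 1 then (1 : ℂ) else 0) =
      t • ((Matrix.of fun i j : Fin N => if (i : ℕ) = (j : ℕ) + 1 then (1 : ℂ) else 0) *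
        Matrix.diagonal (fun i : Fin N => t ^ (i : ℕ))) := by
  ext i j
  simp only [Matrix.diagonal_mul, Matrix.mul_diagonal, Matrix.of_apply, Matrix.smul_apply, smul_eq_mul]
  split_ifs with h
  · rw [h, pow_succ]; ring
  · simp

/-- Transposed form: `Zᵀ D_t = t • D_t Zᵀ`. -/
theorem shiftT_mul_torus (N : ℕ) (t : ℂ) :
    (Matrix.of fun i j : Fin N => if (i : ℕ) = (j : ℕ) + 1 then (1 : ℂ) else 0)ᵀ *
        Matrix.diagonal (fun i : Fin N => t ^ (i : ℕ)) =
      t • (Matrix.diagonal (fun i : Fin N => t ^ (i : ℕ)) *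
        (Matrix.of fun i j : Fin N => if (i : ℕ) = (j : ℕ) + 1 then (1 : ℂ) else 0)ᵀ) := by
  have h := congrArg Matrix.transpose (torus_mul_shift N t)
  rw [Matrix.transpose_mul, Matrix.diagonal_transpose, Matrix.transpose_smul, Matrix.transpose_mul,
    Matrix.diagonal_transpose] at h
  exact h

/-- **`TorusPreservesDisplacement` (the card's first lemma, proved).**  Conjugating by the structure torus commutes
with the Stein displacement: for `t ≠ 0`, `D_t = diag(t^i)`, `D'_t = diag(t^{-i})` (so `D_t D'_t = 1`),
`(D_t A D'_t) − Z (D_t A D'_t) Zᵀ = D_t (A − Z A Zᵀ) D'_t`. -/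
theorem stein_torus_conj (N : ℕ) (t : ℂ) (ht : t ≠ 0) (A : Matrix (Fin N) (Fin N) ℂ) :
    (Matrix.diagonal (fun i : Fin N => t ^ (i : ℕ)) * A * Matrix.diagonal (fun i : Fin N => t⁻¹ ^ (i : ℕ))) -
        (Matrix.of fun i j : Fin N => if (i : ℕ) = (j : ℕ) + 1 then (1 : ℂ) else 0) *
          (Matrix.diagonal (fun i : Fin N => t ^ (i : ℕ)) * A *
            Matrix.diagonal (fun i : Fin N => t⁻¹ ^ (i : ℕ))) *
          (Matrix.of fun i j : Fin N => if (i : ℕ) = (j : ℕ) + 1 then (1 : ℂ) else 0)ᵀ =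
      Matrix.diagonal (fun i : Fin N => t ^ (i : ℕ)) *
        (A - (Matrix.of fun i j : Fin N => if (i : ℕ) = (j : ℕ) + 1 then (1 : ℂ) else 0) * A *
          (Matrix.of fun i j : Fin N => if (i : ℕ) = (j : ℕ) + 1 then (1 : ℂ) else 0)ᵀ) *
        Matrix.diagonal (fun i : Fin N => t⁻¹ ^ (i : ℕ)) := by
  set Z := (Matrix.of fun i j : Fin N => if (i : ℕ) = (j : ℕ) + 1 then (1 : ℂ) else 0) with hZ
  set D := Matrix.diagonal (fun i : Fin N => t ^ (i : ℕ)) with hD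
  set D' := Matrix.diagonal (fun i : Fin N => t⁻¹ ^ (i : ℕ)) with hD'
  -- Z D = t⁻¹ • D Z   and   D' Zᵀ = t • Zᵀ D'
  have h1 : Z * D = t⁻¹ • (D * Z) := by
    have h := torus_mul_shift N t
    rw [← hZ, ← hD] at h
    rw [h, smul_smul, inv_mul_cancel₀ ht, one_smul]
  have h2 : D' * Zᵀ = t • (Zᵀ * D') := by
    have h := shiftT_mul_torus N t⁻¹
    rw [← hZ, ← hD'] at h
    rw [h, smul_smul, mul_inv_cancel₀ ht, one_smul]
  have key : Z * (D * A * D') * Zᵀ = D * (Z * A * Zᵀ) * D' := by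
    calc Z * (D * A * D') * Zᵀ = (Z * D) * A * (D' * Zᵀ) := by
          simp only [Matrix.mul_assoc]
      _ = (t⁻¹ • (D * Z)) * A * (t • (Zᵀ * D')) := by rw [h1, h2]
      _ = (t⁻¹ * t) • (D * Z * A * (Zᵀ * D')) := by
          rw [Matrix.smul_mul, Matrix.smul_mul, Matrix.mul_smul, smul_smul]
      _ = D * (Z * A * Zᵀ) * D' := by
          rw [inv_mul_cancel₀ ht, one_smul]; simp only [Matrix.mul_assoc]
  rw [key, Matrix.mul_sub, Matrix.sub_mul]

/-- Hence the Stein displacement RANK is torus-invariant (`D_t`, `D'_t` have unit determinants). -/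
theorem stein_rank_torus_conj (N : ℕ) (t : ℂ) (ht : t ≠ 0) (A : Matrix (Fin N) (Fin N) ℂ) :
    ((Matrix.diagonal (fun i : Fin N => t ^ (i : ℕ)) * A * Matrix.diagonal (fun i : Fin N => t⁻¹ ^ (i : ℕ))) -
        (Matrix.of fun i j : Fin N => if (i : ℕ) = (j : ℕ) + 1 then (1 : ℂ) else 0) *
          (Matrix.diagonal (fun i : Fin N => t ^ (i : ℕ)) * A *
            Matrix.diagonal (fun i : Fin N => t⁻¹ ^ (i : ℕ))) *
          (Matrix.of fun i j : Fin N => if (i : ℕ) = (j : ℕ) + 1 then (1 : ℂ) else 0)ᵀ).rank =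
      (A - (Matrix.of fun i j : Fin N => if (i : ℕ) = (j : ℕ) + 1 then (1 : ℂ) else 0) * A *
          (Matrix.of fun i j : Fin N => if (i : ℕ) = (j : ℕ) + 1 then (1 : ℂ) else 0)ᵀ).rank := by
  rw [stein_torus_conj N t ht A]
  have hD : IsUnit (Matrix.diagonal (fun i : Fin N => t ^ (i : ℕ))).det := by
    rw [Matrix.det_diagonal]
    exact isUnit_iff_ne_zero.mpr (Finset.prod_ne_zero_iff.mpr fun i _ => pow_ne_zero _ ht)
  have hD' : IsUnit (Matrix.diagonal (fun i : Fin N => t⁻¹ ^ (i : ℕ))).det := by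
    rw [Matrix.det_diagonal]
    exact isUnit_iff_ne_zero.mpr (Finset.prod_ne_zero_iff.mpr fun i _ => pow_ne_zero _ (inv_ne_zero ht))
  rw [Matrix.rank_mul_eq_left_of_isUnit_det _ _ hD', Matrix.rank_mul_eq_right_of_isUnit_det _ _ hD]

/-! ## The corner half of the descent, PROVED (not stubs)

`corner_entry` (entrywise corner identity), `lowest_le_corner` (`w a b ≤ q a − p b`), `lowest_column_entry`,
`masked_corner` (the shadow's MASKED corner identity `S(X) E⁰ = F⁰ (ε ∘ X)`) and `exists_lowest_diagonal` (lowest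
diagonals exist and are attained) — used by the composition; what remains of the descent as a stub is pure rank
semicontinuity along the torus orbit (Stub 2). -/

section corner

variable {r N : ℕ}

/-- The pencil at the matrix unit `single a b 1` is the coefficient `T a b`. -/
theorem pencil_single (T : Fin r → Fin r → Matrix (Fin N) (Fin N) ℂ) (a b : Fin r) :
    (∑ a' : Fin r, ∑ b' : Fin r, (Matrix.single a b (1 : ℂ)) a' b' • T a' b') = T a b := by
  have : ∀ a' b', (Matrix.single a b (1 : ℂ)) a' b' • T a' b' =
      if a = a' ∧ b = b' then T a' b' else 0 := by
    intro a' b'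
    rw [Matrix.single_apply]
    split_ifs <;> simp
  simp_rw [this]
  rw [Finset.sum_eq_single a]
  · rw [Finset.sum_eq_single b]
    · simp
    · intro b' _ hb'
      rw [if_neg]
      rintro ⟨-, h⟩; exact hb' h.symm
    · intro h; exact absurd (Finset.mem_univ b) h
  · intro a' _ ha'
    apply Finset.sum_eq_zero
    intro b' _
    rw [if_neg]
    rintro ⟨h, -⟩; exact ha' h.symm
  · intro h; exact absurd (Finset.mem_univ a) h

/-- Entrywise corner identity: `(T a b · E) i c = [b = c] · F i a`. -/
theorem corner_entry (T : Fin r → Fin r → Matrix (Fin N) (Fin N) ℂ) (E F : Matrix (Fin N) (Fin r) ℂ)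
    (hc : ∀ X : Matrix (Fin r) (Fin r) ℂ, (∑ a : Fin r, ∑ b : Fin r, X a b • T a b) * E = F * X)
    (a b : Fin r) (i : Fin N) (c : Fin r) :
    (T a b * E) i c = if b = c then F i a else 0 := by
  have h := hc (Matrix.single a b (1 : ℂ))
  rw [pencil_single] at h
  rw [h, Matrix.mul_apply]
  have : ∀ k : Fin r, F i k * (Matrix.single a b (1 : ℂ)) k c = if k = a ∧ b = c then F i a else 0 := by
    intro k
    rw [Matrix.single_apply]
    by_cases hk : k = a
    · subst hk
      by_cases hbc : b = c <;> simp [hbc]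
    · have : ¬ (a = k ∧ b = c) := fun h' => hk h'.1.symm
      rw [if_neg this, if_neg (fun h' => hk h'.1)]; simp
  simp_rw [this]
  rw [Finset.sum_eq_single a]
  · simp
  · intro k _ hk; rw [if_neg (fun h' => hk h'.1)]
  · intro h; exact absurd (Finset.mem_univ a) h

/-- The lowest diagonal never lies above the corner diagonal: `w a b ≤ q a − p b`. -/
theorem lowest_le_corner (T : Fin r → Fin r → Matrix (Fin N) (Fin N) ℂ) (E F : Matrix (Fin N) (Fin r) ℂ)
    (p q : Fin r → Fin N) (w : Fin r → Fin r → ℤ)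
    (hc : ∀ X : Matrix (Fin r) (Fin r) ℂ, (∑ a : Fin r, ∑ b : Fin r, X a b • T a b) * E = F * X)
    (hEz : ∀ (c : Fin r) (i : Fin N), i < p c → E i c = 0)
    (hFq : ∀ a : Fin r, F (q a) a = 1)
    (hlb : ∀ (a b : Fin r) (i j : Fin N), T a b i j ≠ 0 → w a b ≤ ((i : ℕ) : ℤ) - ((j : ℕ) : ℤ))
    (a b : Fin r) : w a b ≤ ((q a : ℕ) : ℤ) - ((p b : ℕ) : ℤ) := by
  have h := corner_entry T E F hc a b (q a) b
  rw [if_pos rfl, hFq, Matrix.mul_apply] at h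
  -- some summand is nonzero
  obtain ⟨j, _, hj⟩ := Finset.exists_ne_zero_of_sum_ne_zero (by rw [h]; exact one_ne_zero)
  have hT : T a b (q a) j ≠ 0 := left_ne_zero_of_mul hj
  have hE : E j b ≠ 0 := right_ne_zero_of_mul hj
  have hjp : ¬ j < p b := fun hlt => hE (hEz b j hlt)
  have hjp' : (p b : ℕ) ≤ (j : ℕ) := by
    rw [Fin.lt_def] at hjp; omega
  have := hlb a b (q a) j hT
  omega

/-- On the lowest diagonal, the column `p c` of `T a b` is read off the corner: `T a b i (p c) = [b = c] F i a`
whenever `i − p c = w a b`. -/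
theorem lowest_column_entry (T : Fin r → Fin r → Matrix (Fin N) (Fin N) ℂ) (E F : Matrix (Fin N) (Fin r) ℂ)
    (p q : Fin r → Fin N) (w : Fin r → Fin r → ℤ)
    (hc : ∀ X : Matrix (Fin r) (Fin r) ℂ, (∑ a : Fin r, ∑ b : Fin r, X a b • T a b) * E = F * X)
    (hEp : ∀ c : Fin r, E (p c) c = 1) (hEz : ∀ (c : Fin r) (i : Fin N), i < p c → E i c = 0)
    (hlb : ∀ (a b : Fin r) (i j : Fin N), T a b i j ≠ 0 → w a b ≤ ((i : ℕ) : ℤ) - ((j : ℕ) : ℤ))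
    (a b : Fin r) (i : Fin N) (c : Fin r) (hi : ((i : ℕ) : ℤ) - ((p c : ℕ) : ℤ) = w a b) :
    T a b i (p c) = if b = c then F i a else 0 := by
  have h := corner_entry T E F hc a b i c
  rw [Matrix.mul_apply, Finset.sum_eq_single (p c)] at h
  · rwa [hEp, mul_one] at h
  · intro j _ hj
    by_cases hlt : j < p c
    · rw [hEz c j hlt, mul_zero]
    · have hgt : (p c : ℕ) < (j : ℕ) := by
        rw [Fin.lt_def] at hlt
        have : (j : ℕ) ≠ (p c : ℕ) := fun h' => hj (Fin.ext h')
        omega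
      have hT : T a b i j = 0 := by
        by_contra hne
        have := hlb a b i j hne
        omega
      rw [hT, zero_mul]
  · intro h'; exact absurd (Finset.mem_univ _) h'

/-- **Masked corner of the lowest-diagonal shadow** (the corner half of `stub_shadowDescent`, proved). -/
theorem masked_corner (T : Fin r → Fin r → Matrix (Fin N) (Fin N) ℂ) (E F : Matrix (Fin N) (Fin r) ℂ)
    (p q : Fin r → Fin N) (w : Fin r → Fin r → ℤ)
    (hc : ∀ X : Matrix (Fin r) (Fin r) ℂ, (∑ a : Fin r, ∑ b : Fin r, X a b • T a b) * E = F * X)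
    (hEp : ∀ c : Fin r, E (p c) c = 1) (hEz : ∀ (c : Fin r) (i : Fin N), i < p c → E i c = 0)
    (hFq : ∀ a : Fin r, F (q a) a = 1) (hFz : ∀ (a : Fin r) (i : Fin N), i < q a → F i a = 0)
    (hlb : ∀ (a b : Fin r) (i j : Fin N), T a b i j ≠ 0 → w a b ≤ ((i : ℕ) : ℤ) - ((j : ℕ) : ℤ))
    (S : Fin r → Fin r → Matrix (Fin N) (Fin N) ℂ)
    (hS : ∀ (a b : Fin r) (i j : Fin N), S a b i j =
      if ((i : ℕ) : ℤ) - ((j : ℕ) : ℤ) = w a b then T a b i j else 0)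
    (X : Matrix (Fin r) (Fin r) ℂ) :
    (∑ a : Fin r, ∑ b : Fin r, X a b • S a b) *
        (Matrix.of fun (i : Fin N) (c : Fin r) => if i = p c then (1 : ℂ) else 0) =
      (Matrix.of fun (i : Fin N) (a : Fin r) => if i = q a then (1 : ℂ) else 0) *
        (Matrix.of fun a b : Fin r =>
          if w a b = ((q a : ℕ) : ℤ) - ((p b : ℕ) : ℤ) then X a b else 0) := by
  ext i c
  rw [Matrix.mul_apply, Finset.sum_eq_single (p c)]
  rotate_left
  · intro j _ hj
    simp only [Matrix.of_apply]
    rw [if_neg hj, mul_zero]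
  · intro h'; exact absurd (Finset.mem_univ _) h'
  simp only [Matrix.of_apply, if_true, mul_one]
  rw [Matrix.mul_apply]
  simp only [Matrix.of_apply]
  -- LHS: (Σ_a Σ_b X a b • S a b) i (p c) ;  RHS: Σ_a [i = q a] * mask a c
  rw [Matrix.sum_apply]
  refine Finset.sum_congr rfl fun a _ => ?_
  rw [Matrix.sum_apply]
  simp only [Matrix.smul_apply, smul_eq_mul]
  -- Σ_b X a b * S a b i (p c) = (if i = q a then 1 else 0) * (if w a c = q a - p c then X a c else 0)
  have hwle : w a c ≤ ((q a : ℕ) : ℤ) - ((p c : ℕ) : ℤ) := lowest_le_corner T E F p q w hc hEz hFq hlb a c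
  have key : ∀ b : Fin r, X a b * S a b i (p c) =
      if b = c then (if ((i : ℕ) : ℤ) - ((p c : ℕ) : ℤ) = w a c then X a c * F i a else 0) else 0 := by
    intro b
    rw [hS]
    by_cases hdiag : ((i : ℕ) : ℤ) - ((p c : ℕ) : ℤ) = w a b
    · rw [if_pos hdiag, lowest_column_entry T E F p q w hc hEp hEz hlb a b i c hdiag]
      by_cases hbc : b = c
      · subst hbc; rw [if_pos rfl, if_pos rfl, if_pos hdiag]
      · rw [if_neg hbc, if_neg hbc, mul_zero]
    · rw [if_neg hdiag, mul_zero]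
      by_cases hbc : b = c
      · subst hbc; rw [if_pos rfl, if_neg hdiag]
      · rw [if_neg hbc]
  simp_rw [key]
  rw [Finset.sum_ite_eq' Finset.univ c, if_pos (Finset.mem_univ c)]
  -- case analysis on the position of row i relative to the pivot q a
  by_cases hdiag : ((i : ℕ) : ℤ) - ((p c : ℕ) : ℤ) = w a c
  · rw [if_pos hdiag]
    have hile : (i : ℕ) ≤ (q a : ℕ) := by omega
    rcases Nat.lt_or_eq_of_le hile with hlt | heq
    · -- above the pivot: F i a = 0 and i ≠ q a
      have hFi : F i a = 0 := hFz a i (by rw [Fin.lt_def]; exact hlt)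
      have hne : ¬ (i = q a) := fun h' => by rw [h'] at hlt; exact lt_irrefl _ hlt
      rw [hFi, mul_zero, if_neg hne, zero_mul]
    · -- at the pivot
      have hiq : i = q a := Fin.ext heq
      subst hiq
      rw [hFq, mul_one, if_pos rfl, one_mul, if_pos]
      omega
  · rw [if_neg hdiag]
    by_cases hiq : i = q a
    · subst hiq
      rw [if_pos rfl, one_mul, if_neg]
      intro h'; apply hdiag; omega
    · rw [if_neg hiq, zero_mul]

/-- **Lowest diagonals exist.**  Under the corner identity and the normal form of `E`, `F`, every `T a b` is nonzero
(`(T a b · E) (q a) b = F (q a) a = 1`), so the finite set of weights `i − j` over its support has a minimum `w a b`: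
a lower bound that is attained. -/
theorem exists_lowest_diagonal (T : Fin r → Fin r → Matrix (Fin N) (Fin N) ℂ) (E F : Matrix (Fin N) (Fin r) ℂ)
    (p q : Fin r → Fin N)
    (hc : ∀ X : Matrix (Fin r) (Fin r) ℂ, (∑ a : Fin r, ∑ b : Fin r, X a b • T a b) * E = F * X)
    (hFq : ∀ a : Fin r, F (q a) a = 1) :
    ∃ w : Fin r → Fin r → ℤ,
      (∀ (a b : Fin r) (i j : Fin N), T a b i j ≠ 0 → w a b ≤ ((i : ℕ) : ℤ) - ((j : ℕ) : ℤ)) ∧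
      (∀ a b : Fin r, ∃ i j : Fin N, T a b i j ≠ 0 ∧ ((i : ℕ) : ℤ) - ((j : ℕ) : ℤ) = w a b) := by
  classical
  -- the support-weight set of each block
  let W : Fin r → Fin r → Finset ℤ := fun a b =>
    ((Finset.univ : Finset (Fin N × Fin N)).filter (fun ij => T a b ij.1 ij.2 ≠ 0)).image
      (fun ij => ((ij.1 : ℕ) : ℤ) - ((ij.2 : ℕ) : ℤ))
  have hne : ∀ a b, (W a b).Nonempty := by
    intro a b
    have h := corner_entry T E F hc a b (q a) b
    rw [if_pos rfl, hFq, Matrix.mul_apply] at h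
    obtain ⟨j, _, hj⟩ := Finset.exists_ne_zero_of_sum_ne_zero (by rw [h]; exact one_ne_zero)
    have hT : T a b (q a) j ≠ 0 := left_ne_zero_of_mul hj
    refine ⟨((q a : ℕ) : ℤ) - ((j : ℕ) : ℤ), ?_⟩
    refine Finset.mem_image.mpr ⟨(q a, j), ?_, rfl⟩
    exact Finset.mem_filter.mpr ⟨Finset.mem_univ _, hT⟩
  refine ⟨fun a b => (W a b).min' (hne a b), ?_, ?_⟩
  · intro a b i j hT
    apply Finset.min'_le
    refine Finset.mem_image.mpr ⟨(i, j), ?_, rfl⟩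
    exact Finset.mem_filter.mpr ⟨Finset.mem_univ _, hT⟩
  · intro a b
    have hmem := Finset.min'_mem (W a b) (hne a b)
    obtain ⟨ij, hij, hw⟩ := Finset.mem_image.mp hmem
    have hT : T a b ij.1 ij.2 ≠ 0 := (Finset.mem_filter.mp hij).2
    exact ⟨ij.1, ij.2, hT, hw⟩

end corner

/-! ## Stub 1 — valuation normal form (M, provable now) -/

/-- **Stub 1 (`stub_valuationNormalForm`, size M, provable now).**  Every design `(T, E, F)` with parameters
`(r, N, d)` is carried by the re-basing `X ↦ P X Q` of the corner (`E ↦ E Q`, `F ↦ F P`,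
`T' a' b' = Σ_{a b} P a a' · Q⁻¹ b' b · T a b` — the pencil SPACE is unchanged, so displacement ranks and
nonsingularity are untouched) to a design whose frames are in VALUATION NORMAL FORM: injective pivot maps
`p q : Fin r → Fin N` with `E' (p c) c = 1`, `E' i c = 0` for `i < p c`, and the same for `F'`, `q` (column echelon
form by lowest nonzero row).  Why true: Gaussian elimination on columns ordered by valuation; rank `r` gives `r`
distinct pivots. -/
theorem stub_valuationNormalForm :
    ∀ (r N d : ℕ) (T : Fin r → Fin r → Matrix (Fin N) (Fin N) ℂ) (E F : Matrix (Fin N) (Fin r) ℂ),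
      E.rank = r → F.rank = r →
      (∀ X : Matrix (Fin r) (Fin r) ℂ, (∑ a : Fin r, ∑ b : Fin r, X a b • T a b) * E = F * X) →
      (∀ X : Matrix (Fin r) (Fin r) ℂ, ((∑ a : Fin r, ∑ b : Fin r, X a b • T a b) -
        (Matrix.of fun i j : Fin N => if (i : ℕ) = (j : ℕ) + 1 then (1 : ℂ) else 0) *
        (∑ a : Fin r, ∑ b : Fin r, X a b • T a b) *
        (Matrix.of fun i j : Fin N => if (i : ℕ) = (j : ℕ) + 1 then (1 : ℂ) else 0)ᵀ).rank ≤ d) →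
      (∃ X₀ : Matrix (Fin r) (Fin r) ℂ, (∑ a : Fin r, ∑ b : Fin r, X₀ a b • T a b).det ≠ 0) →
      ∃ (T' : Fin r → Fin r → Matrix (Fin N) (Fin N) ℂ) (E' F' : Matrix (Fin N) (Fin r) ℂ)
        (p q : Fin r → Fin N),
        (E'.rank = r ∧ F'.rank = r ∧
          (∀ X : Matrix (Fin r) (Fin r) ℂ, (∑ a : Fin r, ∑ b : Fin r, X a b • T' a b) * E' = F' * X) ∧
          (∀ X : Matrix (Fin r) (Fin r) ℂ, ((∑ a : Fin r, ∑ b : Fin r, X a b • T' a b) -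
            (Matrix.of fun i j : Fin N => if (i : ℕ) = (j : ℕ) + 1 then (1 : ℂ) else 0) *
            (∑ a : Fin r, ∑ b : Fin r, X a b • T' a b) *
            (Matrix.of fun i j : Fin N => if (i : ℕ) = (j : ℕ) + 1 then (1 : ℂ) else 0)ᵀ).rank ≤ d) ∧
          (∃ X₀ : Matrix (Fin r) (Fin r) ℂ, (∑ a : Fin r, ∑ b : Fin r, X₀ a b • T' a b).det ≠ 0)) ∧
        Function.Injective p ∧ Function.Injective q ∧
        (∀ c : Fin r, E' (p c) c = 1) ∧ (∀ (c : Fin r) (i : Fin N), i < p c → E' i c = 0) ∧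
        (∀ a : Fin r, F' (q a) a = 1) ∧ (∀ (a : Fin r) (i : Fin N), i < q a → F' i a = 0) := by
  sorry

/-! ## Stub 2 — the displacement bound descends to the torus shadow (L, provable now) -/

/-- **Stub 2 (`stub_shadowDescent`, size L, provable now; the explicit `D_t`-orbit / semicontinuity lemma asked for by
triage r1-1).**  INITIAL FORMS OF A BOUNDED-DISPLACEMENT-RANK PENCIL HAVE BOUNDED DISPLACEMENT RANK: let `w a b` be any
lower bound on the weights `i − j` over the support of `T a b` and `S a b` the part of `T a b` on the diagonal
`i − j = w a b`; if `rank (T(X) − Z T(X) Zᵀ) ≤ d` for every `X`, then `rank (S(X) − Z S(X) Zᵀ) ≤ d` for every `X`.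
(No corner, no frames: the corner half of the descent — the masked corner `S(X) E⁰ = F⁰ (ε ∘ X)` — and the existence of
lowest diagonals are PROVED above, `masked_corner` / `exists_lowest_diagonal`.)  Why true: along the torus orbit
`M_t := Σ_{a b} X a b · t^{−w a b} · D_t (T a b) D_t⁻¹ = S(X) + t·P(t)` (entry `(i,j)` of `D_t A D_t⁻¹` is `t^{i−j} A i j`,
exponents `≥ 0` by the lower bound) one has `M_t = D_t T(X̃_t) D_t⁻¹` with `X̃_t a b = t^{−w a b} X a b`, hence
`rank (M_t − Z M_t Zᵀ) = rank (T(X̃_t) − Z T(X̃_t) Zᵀ) ≤ d` for `t ≠ 0` (`stein_rank_torus_conj`, proved above), and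
`rank ≤ d` is a closed condition (`(d+1)`-minors of `M_t − Z M_t Zᵀ` are polynomials in `t` vanishing on `ℂ ∖ {0}`, hence
at `t = 0`).  Size L = the semicontinuity-of-rank formalisation (minors, or `LinearMap` rank under limits). -/
theorem stub_shadowDescent :
    ∀ (r N d : ℕ) (T : Fin r → Fin r → Matrix (Fin N) (Fin N) ℂ) (w : Fin r → Fin r → ℤ)
      (S : Fin r → Fin r → Matrix (Fin N) (Fin N) ℂ),
      (∀ (a b : Fin r) (i j : Fin N), T a b i j ≠ 0 → w a b ≤ ((i : ℕ) : ℤ) - ((j : ℕ) : ℤ)) →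
      (∀ (a b : Fin r) (i j : Fin N), S a b i j =
        if ((i : ℕ) : ℤ) - ((j : ℕ) : ℤ) = w a b then T a b i j else 0) →
      (∀ X : Matrix (Fin r) (Fin r) ℂ, ((∑ a : Fin r, ∑ b : Fin r, X a b • T a b) -
        (Matrix.of fun i j : Fin N => if (i : ℕ) = (j : ℕ) + 1 then (1 : ℂ) else 0) *
        (∑ a : Fin r, ∑ b : Fin r, X a b • T a b) *
        (Matrix.of fun i j : Fin N => if (i : ℕ) = (j : ℕ) + 1 then (1 : ℂ) else 0)ᵀ).rank ≤ d) →
      ∀ X : Matrix (Fin r) (Fin r) ℂ, ((∑ a : Fin r, ∑ b : Fin r, X a b • S a b) -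
        (Matrix.of fun i j : Fin N => if (i : ℕ) = (j : ℕ) + 1 then (1 : ℂ) else 0) *
        (∑ a : Fin r, ∑ b : Fin r, X a b • S a b) *
        (Matrix.of fun i j : Fin N => if (i : ℕ) = (j : ℕ) + 1 then (1 : ℂ) else 0)ᵀ).rank ≤ d := by
  -- the lever this stub starts from (PROVED above): torus conjugation preserves the Stein displacement rank
  have _lever := @stein_rank_torus_conj
  sorry

/-! ## Stub 3 — smoothing rigidity / torus-fixed extremality (XL, HARDEST) -/

/-- **Stub 3 (`stub_smoothingRigidity`, size XL, OPEN — the load-bearing bet of the line).**  Let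
`(S, E⁰ = [e_{p c}], F⁰ = [e_{q a}], w)` be a graded partial-corner configuration — masked corner
`S(X) E⁰ = F⁰ (ε ∘ X)`, `ε a b = [w a b = q a − p b]` (`masked_corner`, proved) and `drk ≤ d` everywhere (Stub 2) — which is
SMOOTHABLE: it is the lowest-diagonal shadow of an honest design `(T, E, F)` in valuation normal form with pivots
`p`, `q` (so the torus orbit of that design is a polynomial arc of honest designs ending at `S`).  Then some GRADED
honest design with the same `r` and the same displacement budget `d` exists (any size `N'`).  Equivalently (given
Stubs 1–2): at fixed `d` the torus-fixed (monomial) class attains every `r` that any design attains — re-acquiring in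
the limit what died there (the bijection `𝒯 → Hom(W, W_F)` where `ε a b = 0`, and nonsingularity) never needs a
non-graded configuration.  Consistent with all data: `d = 1` (`r ≤ 1` both); `d = 2`: graded max `r = 3` (W1), while
non-graded `r = 3` designs are plentiful — this seat's exact check (exp/gconst_shadow.py): `N = 9`, `E = (e₂,e₅,e₈)`,
`g₂ = s³(1 − 2s + 2s³ + 2s⁴ − 2s⁵)` is nonsingular, ADAPTED (`ε ≡ 1`), its shadow has exact corner, `drk 2`, rank 3
(singular); `g₂ = s²·unit` gives nonsingular NON-adapted designs (`ε = 0` on 6 of 9 blocks) — and no `r = 4` design of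
either kind is known (graded: exhaustive `N ≤ 28`, lead; non-graded: unit-perturbations of all roomy shadows `N ≤ 23`, sparse
non-monomial trials `N ≤ 16`, generic-cell smoothings `N ≤ 17` — j016725/j016863 — and the full G-const census `N ≤ 24`,
kit j017955, pending at plan time); W-family `r = 2d − 1` graded for every `d`.
Why it might fail: a non-graded design with `r = 2d` (then the crux survives but this line dies) or with `r > 2d` (an
economical corner: the crux dies); first instance to decide (triage r1-1): is the roomy singular shadow
`(N, c, pos) = (16, 4|12, (3,7,11,15))`, `r = 4`, `d = 2`, smoothable? — the stub predicts NO, to all orders.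
NOT the crux restated: `2d` does not occur; the statement is an existence transfer (design ⟹ graded design) whose
natural proof is degeneration theory (Borel/Białynicki-Birula on the closure of the honest-design locus in a product
of Grassmannians: every orbit closure meets the fixed locus; to show: the open conditions can be re-acquired at SOME
fixed point, uniformly in `N`). -/
theorem stub_smoothingRigidity :
    ∀ (r N d : ℕ) (p q : Fin r → Fin N) (w : Fin r → Fin r → ℤ)
      (S : Fin r → Fin r → Matrix (Fin N) (Fin N) ℂ),
      Function.Injective p → Function.Injective q →
      (∀ X : Matrix (Fin r) (Fin r) ℂ, (∑ a : Fin r, ∑ b : Fin r, X a b • S a b) *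
          (Matrix.of fun (i : Fin N) (c : Fin r) => if i = p c then (1 : ℂ) else 0) =
        (Matrix.of fun (i : Fin N) (a : Fin r) => if i = q a then (1 : ℂ) else 0) *
          (Matrix.of fun a b : Fin r =>
            if w a b = ((q a : ℕ) : ℤ) - ((p b : ℕ) : ℤ) then X a b else 0)) →
      (∀ X : Matrix (Fin r) (Fin r) ℂ, ((∑ a : Fin r, ∑ b : Fin r, X a b • S a b) -
        (Matrix.of fun i j : Fin N => if (i : ℕ) = (j : ℕ) + 1 then (1 : ℂ) else 0) *
        (∑ a : Fin r, ∑ b : Fin r, X a b • S a b) *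
        (Matrix.of fun i j : Fin N => if (i : ℕ) = (j : ℕ) + 1 then (1 : ℂ) else 0)ᵀ).rank ≤ d) →
      (∃ (T : Fin r → Fin r → Matrix (Fin N) (Fin N) ℂ) (E F : Matrix (Fin N) (Fin r) ℂ),
        (E.rank = r ∧ F.rank = r ∧
          (∀ X : Matrix (Fin r) (Fin r) ℂ, (∑ a : Fin r, ∑ b : Fin r, X a b • T a b) * E = F * X) ∧
          (∀ X : Matrix (Fin r) (Fin r) ℂ, ((∑ a : Fin r, ∑ b : Fin r, X a b • T a b) -
            (Matrix.of fun i j : Fin N => if (i : ℕ) = (j : ℕ) + 1 then (1 : ℂ) else 0) *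
            (∑ a : Fin r, ∑ b : Fin r, X a b • T a b) *
            (Matrix.of fun i j : Fin N => if (i : ℕ) = (j : ℕ) + 1 then (1 : ℂ) else 0)ᵀ).rank ≤ d) ∧
          (∃ X₀ : Matrix (Fin r) (Fin r) ℂ, (∑ a : Fin r, ∑ b : Fin r, X₀ a b • T a b).det ≠ 0)) ∧
        (∀ c : Fin r, E (p c) c = 1) ∧ (∀ (c : Fin r) (i : Fin N), i < p c → E i c = 0) ∧
        (∀ a : Fin r, F (q a) a = 1) ∧ (∀ (a : Fin r) (i : Fin N), i < q a → F i a = 0) ∧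
        (∀ (a b : Fin r) (i j : Fin N), T a b i j ≠ 0 → w a b ≤ ((i : ℕ) : ℤ) - ((j : ℕ) : ℤ)) ∧
        (∀ a b : Fin r, ∃ i j : Fin N, T a b i j ≠ 0 ∧ ((i : ℕ) : ℤ) - ((j : ℕ) : ℤ) = w a b) ∧
        (∀ (a b : Fin r) (i j : Fin N), S a b i j =
          if ((i : ℕ) : ℤ) - ((j : ℕ) : ℤ) = w a b then T a b i j else 0)) →
      ∃ (N' : ℕ) (T' : Fin r → Fin r → Matrix (Fin N') (Fin N') ℂ) (E' F' : Matrix (Fin N') (Fin r) ℂ),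
        (E'.rank = r ∧ F'.rank = r ∧
          (∀ X : Matrix (Fin r) (Fin r) ℂ, (∑ a : Fin r, ∑ b : Fin r, X a b • T' a b) * E' = F' * X) ∧
          (∀ X : Matrix (Fin r) (Fin r) ℂ, ((∑ a : Fin r, ∑ b : Fin r, X a b • T' a b) -
            (Matrix.of fun i j : Fin N' => if (i : ℕ) = (j : ℕ) + 1 then (1 : ℂ) else 0) *
            (∑ a : Fin r, ∑ b : Fin r, X a b • T' a b) *
            (Matrix.of fun i j : Fin N' => if (i : ℕ) = (j : ℕ) + 1 then (1 : ℂ) else 0)ᵀ).rank ≤ d) ∧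
          (∃ X₀ : Matrix (Fin r) (Fin r) ℂ, (∑ a : Fin r, ∑ b : Fin r, X₀ a b • T' a b).det ≠ 0)) ∧
        (∃ (p' q' : Fin r → Fin N'),
          (∀ (i : Fin N') (c : Fin r), E' i c ≠ 0 → i = p' c) ∧
          (∀ (i : Fin N') (a : Fin r), F' i a ≠ 0 → i = q' a) ∧
          (∀ (a b : Fin r) (i j : Fin N'), T' a b i j ≠ 0 →
            ((i : ℕ) : ℤ) - ((j : ℕ) : ℤ) = ((q' a : ℕ) : ℤ) - ((p' b : ℕ) : ℤ))) := by
  sorry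

/-! ## Stub 4 — the graded (torus-fixed) case of the crux (L; `GradedHCLR`) -/

/-- **Stub 4 (`stub_gradedBound`, size L; the card's `GradedHCLR`, triage's first contentful stub).**  A GRADED
design — coordinate frames up to scaling (`E i c ≠ 0 → i = p c`, `F i a ≠ 0 → i = q a`) and every `T a b`
supported on the single diagonal `i − j = q a − p b` — which satisfies all five hypotheses of the crux (in
particular NONSINGULARITY, without which stmt-7493's graded `(3,9,1)` has `r = 3 > 2 = 2d`) has `r ≤ 2 d`.  This is
the crux restricted to the torus-fixed locus, where the displacement of each `T a b` is a step function with `≤ d`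
jumps along one diagonal, the corner pins the value `1` at column `p b` and `0` at the other pivot columns, and the
argument is combinatorics of supports plus one use of nonsingularity; known pieces: H-const `r ≤ d`
(`hclR_hconst_bound`), `d = 1 ⇒ r ≤ 1` (`hclR_d_one`), graded G-const capacity law `r (g+1) ≤ 2 d g` (lead, paper;
exhaustive `d = 2`, `r = 4`, `N ≤ 28`: none), graded `(1,1)` class `r ≤ 3` at `d = 2`.  Expected truth `r ≤ 2 d − 1`
for `r ≥ 1` (W-family tight); only `2 d` is needed here.  Why it might fail: a graded rank-`≤ d` displacement space
outside the split classes ("junk bands" covered by long segments) carrying a nonsingular corner with `r > 2 d` — none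
in any census. -/
theorem stub_gradedBound :
    ∀ (r N d : ℕ) (T : Fin r → Fin r → Matrix (Fin N) (Fin N) ℂ) (E F : Matrix (Fin N) (Fin r) ℂ),
      E.rank = r → F.rank = r →
      (∀ X : Matrix (Fin r) (Fin r) ℂ, (∑ a : Fin r, ∑ b : Fin r, X a b • T a b) * E = F * X) →
      (∀ X : Matrix (Fin r) (Fin r) ℂ, ((∑ a : Fin r, ∑ b : Fin r, X a b • T a b) -
        (Matrix.of fun i j : Fin N => if (i : ℕ) = (j : ℕ) + 1 then (1 : ℂ) else 0) *
        (∑ a : Fin r, ∑ b : Fin r, X a b • T a b) *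
        (Matrix.of fun i j : Fin N => if (i : ℕ) = (j : ℕ) + 1 then (1 : ℂ) else 0)ᵀ).rank ≤ d) →
      (∃ X₀ : Matrix (Fin r) (Fin r) ℂ, (∑ a : Fin r, ∑ b : Fin r, X₀ a b • T a b).det ≠ 0) →
      (∃ (p q : Fin r → Fin N),
        (∀ (i : Fin N) (c : Fin r), E i c ≠ 0 → i = p c) ∧
        (∀ (i : Fin N) (a : Fin r), F i a ≠ 0 → i = q a) ∧
        (∀ (a b : Fin r) (i j : Fin N), T a b i j ≠ 0 →
          ((i : ℕ) : ℤ) - ((j : ℕ) : ℤ) = ((q a : ℕ) : ℤ) - ((p b : ℕ) : ℤ))) →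
      r ≤ 2 * d := by
  sorry

/-! ## The composition (kernel-checked; no `sorry` of its own) -/

/-- **`HiddenCornerLemmaR` from the four stubs.**  Given a design `(T, E, F)` with parameters `(r, N, d)`:
Stub 1 puts the frames in valuation normal form; `exists_lowest_diagonal` (proved) supplies the lowest diagonals `w`,
`masked_corner` (proved) the masked corner of the torus shadow `S` (lowest-diagonal truncation, coordinate frames)
and Stub 2 its displacement bound — so `S` is a graded masked-corner configuration, smoothable by construction; Stub 3
yields a GRADED honest design with the same `r` and `d`; Stub 4 bounds it: `r ≤ 2 d`. -/
theorem HiddenCornerLemmaR_of : HiddenCornerLemmaR := by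
  intro r N d T E F hE hF hc hd hns
  -- Stub 1: valuation normal form
  obtain ⟨T₁, E₁, F₁, p, q, ⟨hE₁, hF₁, hc₁, hd₁, hns₁⟩, hp, hq, hEp, hEz, hFq, hFz⟩ :=
    stub_valuationNormalForm r N d T E F hE hF hc hd hns
  -- lowest diagonals (proved) and the torus shadow of (T₁, E₁, F₁)
  obtain ⟨w, hlb, hatt⟩ := exists_lowest_diagonal T₁ E₁ F₁ p q hc₁ hFq
  let S : Fin r → Fin r → Matrix (Fin N) (Fin N) ℂ := fun a b => Matrix.of fun i j =>
    if ((i : ℕ) : ℤ) - ((j : ℕ) : ℤ) = w a b then T₁ a b i j else 0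
  have hS : ∀ (a b : Fin r) (i j : Fin N), S a b i j =
      if ((i : ℕ) : ℤ) - ((j : ℕ) : ℤ) = w a b then T₁ a b i j else 0 :=
    fun a b i j => rfl
  -- masked corner (proved) and displacement bound (Stub 2) of the shadow
  have hcS := masked_corner T₁ E₁ F₁ p q w hc₁ hEp hEz hFq hFz hlb S hS
  have hdS := stub_shadowDescent r N d T₁ w S hlb hS hd₁
  -- Stub 3: smoothable shadow ⟹ a graded honest design with the same (r, d)
  obtain ⟨N₃, T₃, E₃, F₃, ⟨hE₃, hF₃, hc₃, hd₃, hns₃⟩, hgr⟩ :=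
    stub_smoothingRigidity r N d p q w S hp hq hcS hdS
      ⟨T₁, E₁, F₁, ⟨hE₁, hF₁, hc₁, hd₁, hns₁⟩, hEp, hEz, hFq, hFz, hlb, hatt, hS⟩
  -- Stub 4: graded designs obey the bound
  exact stub_gradedBound r N₃ d T₃ E₃ F₃ hE₃ hF₃ hc₃ hd₃ hns₃ hgr

end Summit.MatrixMultiplication.MatrixMultiplication.Cruxes.HiddenCornerLemmaR.TorusShadowSmoothing
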